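import Literature.NumberTheory.PAdicHodge.TateLogCyclotomicClass
import Literature.NumberTheory.GaloisRepresentations.PadicAlgebraIntegral
import HarnessLib

/-!
# Kato, LNM 1553, Ch. II Prop. 1.2.3 — injectivity half — for the TRIVIAL representation: PROVED

Topic `Literature/NumberTheory/PAdicHodge`; continuation of `TateLogCyclotomicClass` (Tate 1967 §3.3,
`H¹` half, scalar case: `[log χ_cyclo] ≠ 0` in `H¹(Γ_F, ℂ_F)`) and of `BlochKatoDualExponential` (Kato's
`exp*` formalism over the tree's period-ring data). THEOREMS ONLY; no named fact, no `sorry`.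

For a `p`-adic field `F` (`hp : v(p) < 1`) and the genuine period-ring datum `𝔅 = bdRPeriodRingData hp`
(`B_dR(F)` with its `Γ_F`-action and filtration `Fil^i = ξ^i B_dR⁺`), the predicate
`𝔅.CupLogInjective (logCyclotomic p) ρ` of `BlochKatoDualExponential` — "if `σ ↦ log χ(σ) · x` is a
coboundary of `Fil⁰B ⊗ V` then `x = 0`, for `x ∈ Fil⁰ D(V)`", the injectivity half of Kato's Prop. 1.2.3
(`∪ log χ : D⁰_dR(V) ≅ H¹(K, B_dR⁺ ⊗ V)`) — is PROVED here for the trivial representation `V = ℚ_p`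
(`ContinuousRep.trivial Γ_F ℚ_p ℚ_p`):

* `PeriodRingData.cupLogInjective_trivial_of` — for ANY period-ring datum `𝔅` (pure algebra): the
  predicate for the trivial representation reduces, through `B ⊗_{ℚ_p} ℚ_p ≅ B` and Fontaine's
  `B^Γ = E` (`invariants_eq`), to the scalar statement "`f ∈ E`, `β ∈ Fil⁰ B`,
  `ψ(σ) · f = σ β − β` for all `σ` ⟹ `f = 0`";
* `cupLogInjective_bdR_trivial` — for `B_dR(F)`: that scalar statement follows by applying
  `θ : B_dR⁺ → ℂ_F` (equivariant, `thetaBdR_galBdRPlus`; `θ ∘ (F ↪ B_dR⁺) = (F ⊆ ℂ_F)`,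
  `thetaBdR_embBdRHom`) and `CompletedAlgClosure.not_exists_smul_eq_add_mul_logCyclotomic`
  (the `F`-line `F · [log χ]` injects into `H¹(Γ_F, ℂ_F)`), the `ℚ_p`-structure of `F` being the
  canonical one by rigidity (`LocalField.ringHom_padic_ext`).

So the cite-only tree fact `cupLogInjective_and_hasDualExp_of_isDeRham` (Kato II Prop. 1.2.3, both
halves, all de Rham `V`) now has its first proved instance: conjunct (a) at `V = ℚ_p`. NOT proved here:
conjunct (a) for non-trivial `V` (needs the Hodge–Tate decomposition of `ℂ_F ⊗ V` and Tate's
`H⁰(ℂ_F(χ^j)) = 0`, the latter in the tree), conjunct (b) `HasDualExp` (needs Tate's `H¹` vanishing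
`H¹(Γ_F, ℂ_F(χ^j)) = 0`, `j ≠ 0`, absent from the tree).

## References

* K. Kato, LNM 1553 (1993), Ch. II §1.2.2–1.2.4, Prop. 1.2.3. [Kato1993LNM1553]
* J. Tate, *p-divisible groups* (1967), §3.3 Theorem 1. [Tate1967]
* J.-M. Fontaine, Astérisque 223 (1994), Exp. II §1.5, Exp. III §1.5. [FontaineAsterisque223III]
-/

noncomputable section

open scoped TensorProduct
open TensorProduct Field ValuativeRel

namespace Literature.NumberTheory.GaloisRepresentations.PeriodRingData

universe u v v' w

variable {Γ : Type u} [Group Γ] [TopologicalSpace Γ] {P : Type v} {E : Type v'} [Field P]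
  [TopologicalSpace P] [Field E] [Algebra P E] (𝔅 : PeriodRingData.{u, v, v', w} Γ P E)

/-! ### The trivial representation: `B ⊗_P P ≅ B` -/

/-- `B ⊗_P P ≅ B` carries the diagonal action of the trivial representation to the action on `B`.
[cite: FontaineAsterisque223III, Exp. III §1.3] -/
theorem rid_tensorRep_trivial (σ : Γ) (y : 𝔅.B ⊗[P] P) :
    TensorProduct.rid P 𝔅.B (𝔅.tensorRep (ContinuousRep.trivial Γ P P) σ y) =
      σ • TensorProduct.rid P 𝔅.B y := by
  induction y using TensorProduct.induction_on with
  | zero => rw [map_zero, map_zero, smul_zero]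
  | tmul b m =>
    rw [tensorRep_apply_tmul, ContinuousRep.trivial_apply, TensorProduct.rid_tmul,
      TensorProduct.rid_tmul]
    exact (smul_comm σ m b).symm
  | add y z hy hz => rw [map_add, map_add, hy, hz, map_add, smul_add]

omit [TopologicalSpace Γ] [TopologicalSpace P] in
/-- `B ⊗_P P ≅ B` is `E`-linear for the left `E`-module structure. [folklore] -/
private theorem rid_smul_left (f : E) (y : 𝔅.B ⊗[P] P) :
    TensorProduct.rid P 𝔅.B (f • y) = f • TensorProduct.rid P 𝔅.B y := by
  induction y using TensorProduct.induction_on with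
  | zero => rw [smul_zero, map_zero, smul_zero]
  | tmul b m =>
    rw [TensorProduct.smul_tmul', TensorProduct.rid_tmul, TensorProduct.rid_tmul, smul_comm]
  | add y z hy hz => rw [smul_add, map_add, hy, hz, map_add, smul_add]

omit [TopologicalSpace Γ] [TopologicalSpace P] in
/-- `B ⊗_P P ≅ B` carries `Fil^i B ⊗ P` into `Fil^i B`. [folklore] -/
private theorem rid_mem_fil_of_mem_filTensor {i : ℤ} {y : 𝔅.B ⊗[P] P} (hy : y ∈ 𝔅.filTensor P i) :
    TensorProduct.rid P 𝔅.B y ∈ 𝔅.fil i := by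
  obtain ⟨z, rfl⟩ := hy
  induction z using TensorProduct.induction_on with
  | zero => rw [map_zero, map_zero]; exact Submodule.zero_mem _
  | tmul b m =>
    rw [AlgebraTensorModule.map_tmul, Submodule.subtype_apply, LinearMap.id_apply, TensorProduct.rid_tmul,
      ← algebraMap_smul E m (b : 𝔅.B)]
    exact Submodule.smul_mem _ _ b.2
  | add y z hy hz => rw [map_add, map_add]; exact Submodule.add_mem _ hy hz

/-- **Kato II Prop. 1.2.3 (injectivity) for the trivial representation, reduced to scalars.** For ANY
period-ring datum `𝔅` and cocycle `ψ : Γ → P`: if every `f ∈ E` for which `σ ↦ ψ(σ) · f` is a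
coboundary `σ β − β` of some `β ∈ Fil⁰ B` vanishes, then `𝔅.CupLogInjective ψ (trivial)` holds — an
invariant `x ∈ (B ⊗ P)^Γ` is `f ⊗ 1`, `f ∈ E = B^Γ` (`invariants_eq`). [cite: Kato1993LNM1553, Ch. II Prop. 1.2.3]
[cite: FontaineAsterisque223III, Exp. III §1.5] -/
theorem cupLogInjective_trivial_of (ψ : Γ → P)
    (h : ∀ (f : E) (β : 𝔅.B), β ∈ 𝔅.fil 0 →
      (∀ σ : Γ, algebraMap P E (ψ σ) • algebraMap E 𝔅.B f = σ • β - β) → f = 0) :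
    𝔅.CupLogInjective ψ (ContinuousRep.trivial Γ P P) := by
  intro x hxD _hxFil hcob
  set e := TensorProduct.rid P 𝔅.B with he
  -- `e x` is `Γ`-invariant, hence a scalar `f ∈ E`
  have hinv : ∀ σ : Γ, σ • e x = e x := fun σ => by
    rw [← rid_tensorRep_trivial, (𝔅.mem_D_iff _ x).mp hxD σ]
  have hmem : e x ∈ {b : 𝔅.B | ∀ σ : Γ, σ • b = b} := hinv
  rw [𝔅.invariants_eq] at hmem
  obtain ⟨f, hf⟩ := hmem
  -- the coboundary, transported to `B`
  obtain ⟨b, hb, hcb⟩ := hcob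
  have hβ : e b ∈ 𝔅.fil 0 := rid_mem_fil_of_mem_filTensor 𝔅 hb
  have hf0 : f = 0 := h f (e b) hβ fun σ => by
    have hcbσ : algebraMap P E (ψ σ) • x = 𝔅.tensorRep (ContinuousRep.trivial Γ P P) σ b - b := hcb σ
    rw [hf, ← rid_smul_left, hcbσ, map_sub, rid_tensorRep_trivial]
  have hex : e x = 0 := by rw [← hf, hf0, map_zero]
  exact e.injective (by rw [hex, map_zero])

end Literature.NumberTheory.GaloisRepresentations.PeriodRingData

namespace Literature.NumberTheory.PAdicHodge

open WittVector
open Literature.NumberTheory.GaloisRepresentations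
open Literature.NumberTheory.GaloisRepresentations.IsNonarchimedeanLocalField

variable {F : Type} [Field F] [ValuativeRel F] [TopologicalSpace F] [IsNonarchimedeanLocalField F]
  [CharZero F] {p : ℕ} [Fact p.Prime] [Fact (¬ IsUnit (p : integerC F))]
  [IsAdicComplete (Ideal.span {(p : integerC F)}) (integerC F)] (hp : valuation F p < 1) [Algebra ℚ_[p] F]

/-- **The scalar coboundary statement in `B_dR(F)`**: if `f ∈ F`, `β ∈ B_dR⁺(F) = Fil⁰ B_dR(F)` and
`log χ(σ) · f = σ β − β` in `B_dR(F)` for all `σ ∈ Γ_F`, then `f = 0` — apply `θ : B_dR⁺ → ℂ_F` and Tate's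
`H¹` theorem `CompletedAlgClosure.not_exists_smul_eq_add_mul_logCyclotomic`.
[cite: Tate1967, §3.3 Theorem 1] [cite: FontaineAsterisque223III, Exp. II §1.5.2–1.5.5] -/
theorem eq_zero_of_logCyclotomic_smul_eq_coboundary_bdR (f : F) (β : (bdRPeriodRingData (F := F) (p := p) hp).B)
    (hβ : β ∈ (bdRPeriodRingData (F := F) (p := p) hp).fil 0)
    (h : ∀ σ : absoluteGaloisGroup F,
      algebraMap ℚ_[p] F (logCyclotomic p σ) • algebraMap F (bdRPeriodRingData (F := F) (p := p) hp).B f =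
        σ • β - β) : f = 0 := by
  have hF : Function.Surjective (fontaineTheta (integerC F) p) := surjective_fontaineTheta_integerC hp
  haveI : IsDomain (BDeRhamPlus (integerC F) p) := isDomain_bDeRhamPlus hF
  letI : Algebra F (FracBdR F p) := fracAlgebra (p := p) hp hF
  -- `β = b ∈ B_dR⁺`
  obtain ⟨b, hb⟩ := (mem_fil_iff hp hF).mp hβ
  rw [zpow_zero, one_mul] at hb
  -- the canonical `ℚ_p`-structure
  have halg : ∀ c : ℚ_[p], algebraMap ℚ_[p] F c = LocalField.padicRingHom F p hp c := fun c =>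
    RingHom.congr_fun (LocalField.ringHom_padic_ext (algebraMap ℚ_[p] F) (LocalField.padicRingHom F p hp)) c
  -- the identity in `B_dR⁺`, then in `ℂ_F`
  have hB : ∀ σ : absoluteGaloisGroup F,
      embBdRHom hp hF (algebraMap ℚ_[p] F (logCyclotomic p σ) * f) = galBdRPlus σ b - b := by
    intro σ
    apply algebraMap_fracBdR_injective (F := F) (p := p)
    have h1 := h σ
    rw [hb] at h1
    change algebraMap ℚ_[p] F (logCyclotomic p σ) • algebraMap F (FracBdR F p) f =
      σ • algebraMap (BDeRhamPlus (integerC F) p) (FracBdR F p) b -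
        algebraMap (BDeRhamPlus (integerC F) p) (FracBdR F p) b at h1
    rw [Algebra.smul_def, ← map_mul, algebraMap_fracAlgebra, smul_algebraMap_fracBdR, ← map_sub] at h1
    exact h1
  by_contra hf
  refine CompletedAlgClosure.not_exists_smul_eq_add_mul_logCyclotomic hp hf ⟨thetaBdR b, fun σ => ?_⟩
  have h2 := congrArg thetaBdR (hB σ)
  rw [thetaBdR_embBdRHom, map_sub, thetaBdR_galBdRPlus, map_mul, halg, mul_comm] at h2
  rw [h2, add_sub_cancel]

/-- **Kato, LNM 1553, Ch. II Prop. 1.2.3 — injectivity of `∪ log χ_cyclo` on `D⁰_dR` — for the TRIVIAL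
representation `V = ℚ_p` over the genuine `B_dR(F)`: PROVED.** For every `p`-adic field `F`
(`hp : v(p) < 1`, any `ℚ_p`-algebra structure — it is the canonical one):
`(bdRPeriodRingData hp).CupLogInjective (logCyclotomic p) (ContinuousRep.trivial Γ_F ℚ_p ℚ_p)`, i.e.
for `x ∈ D⁰_dR(ℚ_p) = F`, if `σ ↦ log χ(σ) · x` is a coboundary of `B_dR⁺` then `x = 0` — the first proved
instance of conjunct (a) of the cite-only `cupLogInjective_and_hasDualExp_of_isDeRham`. Chain:
`PeriodRingData.cupLogInjective_trivial_of` (pure algebra) + `eq_zero_of_logCyclotomic_smul_eq_coboundary_bdR`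
(`θ` + Tate's `H¹` theorem). [cite: Kato1993LNM1553, Ch. II Prop. 1.2.3] [cite: Tate1967, §3.3 Theorem 1] -/
theorem cupLogInjective_bdR_trivial :
    (bdRPeriodRingData (F := F) (p := p) hp).CupLogInjective (logCyclotomic p)
      (ContinuousRep.trivial (absoluteGaloisGroup F) ℚ_[p] ℚ_[p]) :=
  PeriodRingData.cupLogInjective_trivial_of _ _ fun f β hβ h =>
    eq_zero_of_logCyclotomic_smul_eq_coboundary_bdR hp f β hβ h

end Literature.NumberTheory.PAdicHodge

end
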